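import Summits.QuantumFields.BalabanUV.T4Continuum.Spine.CovariantAveragingTower
import Summits.QuantumFields.BalabanUV.T4Continuum.Support.OutputRateInsertion

/-!
# OutputRateTowerSocket — row NE5's wall W1 (`StepModel.OperatorRate`) fed BY NAME from row NE2's typed wall shape
# `CovariantAveragingTower.OneStepAveragedLaw` (the one-step covariant comparison ⇐ G-an2-4), and the row-NE5 END theorem
# restated with that input: NE5 ⇐ NE2-law ∧ (reading) ∧ W2 ∧ W3 ∧ W4-or-its-producer ∧ MI-R ∧ S ∧ R; plus the minimiser
# split in which row NE3's `T4EtaRateMin.LocalRate` enters W1 beside NE2's law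
# (cell `pub-balaban`, T⁴-continuum fan-out, `HOME/BINDER-OWNERS.md` row NE5, owner lineage t4-ne5-p1, generation 26;
# LEAN PLACEMENT RULE 2026-08-19: the cell's own bookkeeping lives under `Summits/`)

HONEST FRAMING (T4-DAG PAGE 1).  The cell's T⁴ target is rung (B)+1: existence AND uniqueness of the ε → 0 limit of
gauge-invariant observables on a FIXED finite torus T⁴ — NOT infinite volume, NOT a mass gap, NOT the Clay problem.  The
spine estimate NE5 («η-rate of the one-step outputs as functionals of V», shape `T4OutputRate.NE5`) is NOT PRINTED in
[Balaban1987RG1]–[Balaban1989LargeFieldII] (the papers print ε-UNIFORM BOUNDS, never two-spacing RATES; cell GAPS G-t4-U3-1)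
and is NOT PROVED here or anywhere in the tree.  Row NE2's one-step covariant comparison (`OneStepAveragedLaw` at U ≠ 1)
is NOT PRINTED either (cell GAPS G-t4-U1a-1; open row G-an2-4) and is NOT PROVED here: it is a HYPOTHESIS SHAPE of the
imported module `Spine/CovariantAveragingTower`, asserted by nobody.  Every `StepModel`, every tower family and every
reading map below is ABSTRACT DATA; nothing of Bałaban's text is asserted; no «…» print quotation is introduced (0 cite
tags; the located print of every wall is in the imported leaves' docstrings and in the lineage record
`t4/T4-EST-NE5-P1.md`).  `FlowStep.BetaPertH`, (B), (B^μ) do not occur and are NOT hidden: they would enter only through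
the constant `Cop` of the tower law and the window `W` of whoever instantiates.  Spine estimates PROVED: 0/9, unchanged.
HONEST DEPENDENCY (cell, verbatim): continuum YM on T⁴ ⇐ BetaPertH ∧ nine spine estimates (0/9 proved); BetaPertH ⇐ (D1)
∧ (D4) ∧ CAP+tail; G-an2-4 gates asym, D1 and NE2/3/4.

WHAT THIS MODULE IS.  `HOME/BINDER-OWNERS.md` row NE5 books the route-P1 residual as «W1 `StepModel.OperatorRate` = NE2 ∧
NE3 (rows NE2/NE3, hence after G-an2-4) ∕ W2 ∕ W3 ∕ W4 ∕ MI-R ∕ S ∕ R», and the owner item (h′) as «instantiate W1 from NE2 ∧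
NE3's LANDED statement ≤ 1 generation after it lands».  Row NE2's prover lineage has meanwhile TYPED its U ≠ 1 wall in the
generality the spine needs (`CovariantAveragingTower.OneStepAveragedLaw A r X e`: `‖A_k X_{k+1} A_kᴴ − r⁻¹X_k‖ ≤ r⁻¹e_k`
over an arbitrary tower of finite index types, with the kernel reduction `opNorm_avgTow_succ_sub_le`: consecutive
unit-lattice images differ by `≤ e_k`).  This leaf is the JUNCTION, written ahead of (h′) so that on the day G-an2-4
supplies an instance of `OneStepAveragedLaw` the W1 binder of row NE5 is discharged by instantiation and nothing else:

* §1 `TowerContracting A r` / `TowerLaw A X r Cop θ` — a FAMILY of averaging towers indexed by an abstract `J` (one tower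
  per operator item, torus and background datum an instantiation needs; varying unit tori are different indices), each
  with `‖A j k‖² ≤ r⁻¹` and row NE2's law with ONE constant `Cop` and geometric errors `Cop·θ^k` — ROW NE2's WALL BY NAME;
  `ReadsTower M A X r W cR tow` — the READING binder (MI-R-op, liaison `T4OperatorRateLiaison` (L1)–(L2) made a named
  hypothesis): at step `k`, couplings `g`, background datum `U`, the step model's operator discrepancy `‖opA − opB‖` is at
  most `cR ×` the unit-lattice increment `‖avgTow (k+1) − avgTow k‖` of the tower `tow k g U` (run A has `k` fine levels
  below the common unit torus, run B — paired step `k + 1`, `T4OutputRate.Carriers.scale` — has `k + 1`); entrywise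
  variant `ReadsTowerEntrywise` for `Op = S → ℂ` (one tower per entry).  Theorems `absRate_of_towerLaw`,
  `absRate_of_towerLaw_entrywise` (⇒ the liaison's `AbsOperatorRate M W (cR·Cop) θ`) and `operatorRate_of_towerLaw_floor`
  (+ an [I]-type margin floor `r₀ ≤ rOp k` ⇒ W1 `OperatorRate W (cR·Cop/r₀) θ`).
* §2 THE ROW-NE5 END FACES WITH W1 := ROW NE2's LAW: `ne5_at_of_towerLaw_lip_nat` (slower-rate face; = the Data leaf's
  `ne5_at_of_stepModel_lip_nat` with `hop` produced by §1), `ne5_threshold_of_towerLaw_lip_nat` (Sharp face, no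
  smallness), and `ne5_at_of_towerLaw_lip_readsIns_nat` (W4 PRODUCED from the same W1 by `OutputRateInsertion.
  insertionRate_of_operatorRate` — NO η-rate binder other than row NE2's law is left: NE5 ⇐ NE2-law ∧ ReadsTower ∧ W2 ∧
  W2-ins ∧ W3 ∧ MI-R ∧ ReadsIns ∧ S ∧ R).
* §3 THE MINIMISER SPLIT (liaison §4, the instantiation that reads the operators at the runs' OWN minimisers): W1 ⇐
  [NE2's law for the pair (run A, intermediate family `opMid`)] + [operator Lipschitz in the background] × [row NE3's
  `T4EtaRateMin.LocalRate` BY NAME] — `operatorRate_of_towerLaw_split`; END face `ne5_at_of_towerLaw_split_lip_nat`.  This is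
  the literal «W1 = NE2 ∧ NE3» of the row's booking, both rows' shapes consumed by name.
* §3b (v1.1) `ne5_at_of_towerLaw_split_readsIns_nat` — §3's split W1 AND §2's produced W4 in ONE END face (no η-rate binder except
  row NE2's law and row NE3's `LocalRate`).
* NON-VACUITY and the NEGATIVE CONTROL live in the sibling `Support/OutputRateTowerSocketWitness.lean` (≤ 400-line rule):
  a one-site tower family read by the Data leaf's `toyModel` (§2's first face fires end-to-end, constant `31/30`), and the
  liaison's `finestToyModel` (a persistent lattice-scale entry) reading NO contracting tower family at a rate `θ < 1`.

SCOPE OF THE READING (said once, honestly).  `ReadsTower` covers the operator species of an instantiation that ARE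
(Lipschitz images of) unit-lattice images of averaged level objects — the unit-lattice kernels of [II] (2.15)–(2.17) and
whatever row NE2's towers `X k = G_k(U_k), H_k(U_k), C^{(k)}(U_k)` deliver on the unit lattice (liaison (L2): «NE2PlusUnit,
clean θ^k»).  Fine-lattice propagator species measured in (1.7)'s cube norms at sites of NON-unit size carry King-type
rate factors (`T4EtaRate.rateFactor`) and are NOT made tower-readable by this leaf; they enter W1 through the liaison's
`EntrywiseRate` (`OutputRateResidual` §2) — or not at all where an entry persists (sibling witness leaf).  Which species occur in [II]'s step
is a READING of the instantiation (liaison (L2)), not a theorem.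

VERSION.  v1.1 = v1 (p203601) + §3b `ne5_at_of_towerLaw_split_readsIns_nat` (APPEND-ONLY: the split W1 of §3 AND the produced W4 of
§2's third face in ONE END statement — asked for in advance for node U2's tower socket, journal l.3610/l.3631; every v1 declaration
byte-identical).

WHAT IS PROVED: real bookkeeping only (sup-norm packaging, one geometric comparison `θ₂^k ≤ θ^k`, compositions of the
imported theorems BY NAME).  0 sorry; axioms ⊆ {propext, Classical.choice, Quot.sound};
imports the LANDED modules `Spine/CovariantAveragingTower` (row NE2, p201570) and `Support/OutputRateInsertion` (row NE5,
p202795; it imports `OutputRateResidual`, the liaison and the whole Cauchy chain) and modifies nothing of them.  NOT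
COVERED: any instance of `OneStepAveragedLaw` at U ≠ 1 (G-an2-4), of `LocalRate` for minimisers (row NE3), of W2/W3/MI-R
for Bałaban's objects; the species list of an instantiation; NE2, NE3, NE5, BetaPertH, (B), (B^μ).  Rung (B)+1 finite
T⁴; NOT summit progress.
-/

noncomputable section

open Set Metric
open scoped Matrix Matrix.Norms.L2Operator

namespace Summit.QuantumFields.BalabanUV.T4Continuum.OutputRateTowerSocket

open Literature.MathematicalPhysics.QuantumFieldTheory.Balaban1983to89
open Literature.MathematicalPhysics.QuantumFieldTheory.Balaban1983to89.T4OutputRate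
open Literature.MathematicalPhysics.QuantumFieldTheory.Balaban1983to89.T4InputCauchyRate
open Literature.MathematicalPhysics.QuantumFieldTheory.Balaban1983to89.T4InputCauchyRateData
open Literature.MathematicalPhysics.QuantumFieldTheory.Balaban1983to89.T4InputCauchyRateSharp
open Literature.MathematicalPhysics.QuantumFieldTheory.Balaban1983to89.T4OperatorRateLiaison
open Literature.MathematicalPhysics.QuantumFieldTheory.Balaban1983to89.T4EtaRateMin
open Summit.QuantumFields.BalabanUV.T4Continuum.CovariantAveragingTower
open Summit.QuantumFields.BalabanUV.T4Continuum.OutputRateInsertion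

/-! ## §1 Tower families (row NE2's carrier), the tower law BY NAME, and the reading of the operator species -/

section Towers

variable {J : Type*} {ι : J → ℕ → Type*} [∀ j k, Fintype (ι j k)] [∀ j k, DecidableEq (ι j k)]

/-- HYPOTHESIS SHAPE (the printed TYPE of an averaging operator: rows orthogonal with squared norm `L^{−d}`; row NE2's
`hA`): every one-step averaging of every tower of the family satisfies `‖A j k‖² ≤ r⁻¹`. [folklore] -/
def TowerContracting (A : (j : J) → (k : ℕ) → Matrix (ι j k) (ι j (k + 1)) ℂ) (r : ℝ) : Prop :=
  ∀ j k, ‖A j k‖ ^ 2 ≤ r⁻¹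

/-- **ROW NE2's WALL, BY NAME, FOR A FAMILY** (NOT PRINTED at U ≠ 1 — the one-step covariant comparison, open row
G-an2-4; a THEOREM at U = 1 in row NE2's leaves): every tower `j` of the family obeys
`CovariantAveragingTower.OneStepAveragedLaw (A j) r (X j) (fun k => Cop·θ^k)` with ONE constant `Cop` and ONE rate `θ`.
[folklore] -/
def TowerLaw (A : (j : J) → (k : ℕ) → Matrix (ι j k) (ι j (k + 1)) ℂ) (X : (j : J) → (k : ℕ) → Matrix (ι j k) (ι j k) ℂ)
    (r Cop θ : ℝ) : Prop :=
  ∀ j, OneStepAveragedLaw (A j) r (X j) (fun k => Cop * θ ^ k)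

/-- Under the law and the contraction, consecutive unit-lattice images of every tower differ by at most `Cop·θ^k` — row
NE2's `opNorm_avgTow_succ_sub_le`, quantified over the family. [folklore] -/
theorem norm_avgTow_succ_sub_le_of_towerLaw {A : (j : J) → (k : ℕ) → Matrix (ι j k) (ι j (k + 1)) ℂ}
    {X : (j : J) → (k : ℕ) → Matrix (ι j k) (ι j k) ℂ} {r Cop θ : ℝ} (hr : 0 < r) (hA : TowerContracting A r)
    (hlaw : TowerLaw A X r Cop θ) (j : J) (k : ℕ) :
    ‖avgTow (A j) r (X j) (k + 1) - avgTow (A j) r (X j) k‖ ≤ Cop * θ ^ k :=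
  opNorm_avgTow_succ_sub_le (A j) hr (hA j) (X j) (e := fun k => Cop * θ ^ k) k (hlaw j k)

variable {C : Carriers} {Op Hist : Type*} [NormedAddCommGroup Op] [NormedSpace ℂ Op] [NormedAddCommGroup Hist]
  [NormedSpace ℂ Hist]

/-- HYPOTHESIS SHAPE `ReadsTower` (MI-R-op, the READING of the operator species; liaison (L1)–(L2) as a named binder): at
every step `k`, coupling sequence `g ∈ W` and background datum `U`, the two runs' operator data of the step model differ,
in the model's operator norm, by at most `cR` times the unit-lattice increment between levels `k` and `k + 1` of the tower
`tow k g U` of the family (run A: `k` fine levels under the common unit torus; run B, paired step `k + 1`: `k + 1`).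
Abstract: which tower an instantiation reads where is data (`tow`), not a theorem. [folklore] -/
def ReadsTower (M : StepModel C Op Hist) (A : (j : J) → (k : ℕ) → Matrix (ι j k) (ι j (k + 1)) ℂ)
    (X : (j : J) → (k : ℕ) → Matrix (ι j k) (ι j k) ℂ) (r : ℝ) (W : Set (ℕ → ℝ)) (cR : ℝ)
    (tow : ℕ → (ℕ → ℝ) → C.BgB → J) : Prop :=
  ∀ k, ∀ g ∈ W, ∀ U : C.BgB,
    ‖M.opA g U k - M.opB g U k‖ ≤
      cR * ‖avgTow (A (tow k g U)) r (X (tow k g U)) (k + 1) - avgTow (A (tow k g U)) r (X (tow k g U)) k‖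

/-- **W1's ABSOLUTE CURRENCY FROM ROW NE2's LAW**: contraction ∧ tower law (`Cop`, `θ`) ∧ reading (`cR`) ⇒ the liaison's
`AbsOperatorRate M W (cR·Cop) θ`. [folklore] -/
theorem absRate_of_towerLaw (M : StepModel C Op Hist) {A : (j : J) → (k : ℕ) → Matrix (ι j k) (ι j (k + 1)) ℂ}
    {X : (j : J) → (k : ℕ) → Matrix (ι j k) (ι j k) ℂ} {r Cop θ cR : ℝ} {W : Set (ℕ → ℝ)}
    {tow : ℕ → (ℕ → ℝ) → C.BgB → J} (hr : 0 < r) (hA : TowerContracting A r) (hlaw : TowerLaw A X r Cop θ)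
    (hread : ReadsTower M A X r W cR tow) (hcR : 0 ≤ cR) : AbsOperatorRate M W (cR * Cop) θ := by
  intro k g hg U
  calc ‖M.opA g U k - M.opB g U k‖
      ≤ cR * ‖avgTow (A (tow k g U)) r (X (tow k g U)) (k + 1) - avgTow (A (tow k g U)) r (X (tow k g U)) k‖ :=
        hread k g hg U
    _ ≤ cR * (Cop * θ ^ k) :=
        mul_le_mul_of_nonneg_left (norm_avgTow_succ_sub_le_of_towerLaw hr hA hlaw (tow k g U) k) hcR
    _ = cR * Cop * θ ^ k := by ring

/-- **W1 IN MARGIN UNITS FROM ROW NE2's LAW**: as above plus an [I]-type margin floor `r₀ ≤ rOp k` ⇒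
`StepModel.OperatorRate W (cR·Cop/r₀) θ` (the liaison's `operatorRate_of_absRate_floor` BY NAME). [folklore] -/
theorem operatorRate_of_towerLaw_floor (M : StepModel C Op Hist)
    {A : (j : J) → (k : ℕ) → Matrix (ι j k) (ι j (k + 1)) ℂ} {X : (j : J) → (k : ℕ) → Matrix (ι j k) (ι j k) ℂ}
    {r Cop θ cR r₀ : ℝ} {W : Set (ℕ → ℝ)} {tow : ℕ → (ℕ → ℝ) → C.BgB → J} (hr : 0 < r) (hA : TowerContracting A r)
    (hlaw : TowerLaw A X r Cop θ) (hread : ReadsTower M A X r W cR tow) (hcR : 0 ≤ cR) (hCop : 0 ≤ Cop) (hθ : 0 ≤ θ)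
    (hfl : ∀ k, r₀ ≤ M.rOp k) (hr₀ : 0 < r₀) : M.OperatorRate W (cR * Cop / r₀) θ :=
  operatorRate_of_absRate_floor M (absRate_of_towerLaw M hr hA hlaw hread hcR) hfl hr₀ (mul_nonneg hcR hCop) hθ

variable {S : Type*} [Fintype S]

/-- HYPOTHESIS SHAPE `ReadsTowerEntrywise` (the reading for the liaison's entrywise currency `Op = S → ℂ`): entry `s` of the
step-`k` operator discrepancy is at most `cR` times the increment of the tower `tow k g U s` (one tower per entry: different
items, tori and sites are different indices of the family). [folklore] -/
def ReadsTowerEntrywise (M : StepModel C (S → ℂ) Hist) (A : (j : J) → (k : ℕ) → Matrix (ι j k) (ι j (k + 1)) ℂ)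
    (X : (j : J) → (k : ℕ) → Matrix (ι j k) (ι j k) ℂ) (r : ℝ) (W : Set (ℕ → ℝ)) (cR : ℝ)
    (tow : ℕ → (ℕ → ℝ) → C.BgB → S → J) : Prop :=
  ∀ k, ∀ g ∈ W, ∀ (U : C.BgB) (s : S),
    ‖M.opA g U k s - M.opB g U k s‖ ≤
      cR * ‖avgTow (A (tow k g U s)) r (X (tow k g U s)) (k + 1) - avgTow (A (tow k g U s)) r (X (tow k g U s)) k‖

/-- The entrywise reading gives the same absolute rate in the sup norm. [folklore] -/
theorem absRate_of_towerLaw_entrywise (M : StepModel C (S → ℂ) Hist)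
    {A : (j : J) → (k : ℕ) → Matrix (ι j k) (ι j (k + 1)) ℂ} {X : (j : J) → (k : ℕ) → Matrix (ι j k) (ι j k) ℂ}
    {r Cop θ cR : ℝ} {W : Set (ℕ → ℝ)} {tow : ℕ → (ℕ → ℝ) → C.BgB → S → J} (hr : 0 < r) (hA : TowerContracting A r)
    (hlaw : TowerLaw A X r Cop θ) (hread : ReadsTowerEntrywise M A X r W cR tow) (hcR : 0 ≤ cR) (hCop : 0 ≤ Cop)
    (hθ : 0 ≤ θ) : AbsOperatorRate M W (cR * Cop) θ := by
  intro k g hg U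
  rw [pi_norm_le_iff_of_nonneg (by positivity)]
  intro s
  calc ‖(M.opA g U k - M.opB g U k) s‖ = ‖M.opA g U k s - M.opB g U k s‖ := rfl
    _ ≤ cR * ‖avgTow (A (tow k g U s)) r (X (tow k g U s)) (k + 1)
          - avgTow (A (tow k g U s)) r (X (tow k g U s)) k‖ := hread k g hg U s
    _ ≤ cR * (Cop * θ ^ k) :=
        mul_le_mul_of_nonneg_left (norm_avgTow_succ_sub_le_of_towerLaw hr hA hlaw (tow k g U s) k) hcR
    _ = cR * Cop * θ ^ k := by ring

end Towers

/-! ## §2 The row-NE5 END faces with W1 := row NE2's tower law -/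

section EndFaces

variable {J : Type*} {ι : J → ℕ → Type*} [∀ j k, Fintype (ι j k)] [∀ j k, DecidableEq (ι j k)]
variable {C : Carriers} {Op Hist : Type*} [NormedAddCommGroup Op] [NormedSpace ℂ Op] [NormedAddCommGroup Hist]
  [NormedSpace ℂ Hist] (M : StepModel C Op Hist)

/-- **ROW NE5's END, SLOWER-RATE FACE, W1 := ROW NE2's LAW.**  Binders: NE2 = `hr`/`hA`/`hlaw` (contraction + tower law,
constant `Cop`, rate `θ`); reading `hread` (`cR`) + margin floor `hfl` (`r₀`); MI-R `hrA`/`hrB`/`hbase`; W2 `hlip`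
(`DataLipschitz κ Λ ρ₀`); decay levels `hdA`/`hdB`; W4 `hins` (`InsertionRate κ E₀ δ′ θ`); W3 consumed `hdamp`; R `hnear`/`hfirst`;
S `hsmall`.  Conclusion: `NE5 EA EB W κ θ′ C₅` at every `θ′ ∈ [θ, 1]` past the threshold, with
`C₅ = (Λ(cR·Cop/r₀ + δ′) + B)(θ′ − ω)/(θ′ − (ω + Λc))` — the Data leaf's `ne5_at_of_stepModel_lip_nat` with `hop` from §1.
[folklore] -/
theorem ne5_at_of_towerLaw_lip_nat {A : (j : J) → (k : ℕ) → Matrix (ι j k) (ι j (k + 1)) ℂ}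
    {X : (j : J) → (k : ℕ) → Matrix (ι j k) (ι j k) ℂ} {r Cop cR r₀ : ℝ} {tow : ℕ → (ℕ → ℝ) → C.BgB → J}
    {EA : Functional C C.BgA} {EB : Functional C C.BgB} {W : Set (ℕ → ℝ)} {κ Λ EA₀ E₀ δ' θ θ' c ω ρ₀ B : ℝ} {k₀ : ℕ}
    (hr : 0 < r) (hA : TowerContracting A r) (hlaw : TowerLaw A X r Cop θ) (hread : ReadsTower M A X r W cR tow)
    (hcR : 0 ≤ cR) (hCop : 0 ≤ Cop) (hfl : ∀ k, r₀ ≤ M.rOp k) (hr₀ : 0 < r₀) (hrA : M.RepresentsA EA W)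
    (hrB : M.RepresentsB EB W) (hbase : M.InBase EB W) (hlip : M.DataLipschitz W κ Λ ρ₀) (hdA : DecayBound EA W EA₀ κ)
    (hdB : DecayBound EB W E₀ κ) (hins : M.InsertionRate W κ E₀ δ' θ) (hdamp : M.InsertionDampedNat W κ c ω)
    (hΛ : 0 ≤ Λ) (hδ' : 0 ≤ δ') (hθ : 0 ≤ θ) (hθθ' : θ ≤ θ') (hθ'1 : θ' ≤ 1) (hc : 0 ≤ c) (hω : 0 < ω)
    (hnear : (cR * Cop / r₀ + δ') * θ ^ k₀ + c * (EA₀ + E₀) / (1 - ω) ≤ ρ₀) (hB : 0 ≤ B)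
    (hfirst : ∀ k < k₀, EA₀ + E₀ ≤ B * θ ^ k) (hsmall : ω + Λ * c < θ') :
    NE5 EA EB W κ θ' ((Λ * (cR * Cop / r₀ + δ') + B) * (θ' - ω) / (θ' - (ω + Λ * c))) :=
  M.ne5_at_of_stepModel_lip_nat hrA hrB hbase hlip hdA hdB
    (operatorRate_of_towerLaw_floor M hr hA hlaw hread hcR hCop hθ hfl hr₀) hins hdamp hΛ
    (add_nonneg (div_nonneg (mul_nonneg hcR hCop) hr₀.le) hδ') hθ hθθ' hθ'1 hc hω hnear hB hfirst hsmall

/-- **ROW NE5's END, THRESHOLD FACE (no smallness), W1 := ROW NE2's LAW** — the Sharp leaf's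
`ne5_threshold_of_stepModel_lip_nat` with `hop` from §1: when the input rate is strictly faster than the threshold
(`θ < ω + Λc`, `ω < 1`), NE5 holds AT `ω + Λc` with the k-uniform constant `(Λ(cR·Cop/r₀ + δ′) + B)·max 1 (Λc/(ω + Λc − θ))`.
[folklore] -/
theorem ne5_threshold_of_towerLaw_lip_nat {A : (j : J) → (k : ℕ) → Matrix (ι j k) (ι j (k + 1)) ℂ}
    {X : (j : J) → (k : ℕ) → Matrix (ι j k) (ι j k) ℂ} {r Cop cR r₀ : ℝ} {tow : ℕ → (ℕ → ℝ) → C.BgB → J}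
    {EA : Functional C C.BgA} {EB : Functional C C.BgB} {W : Set (ℕ → ℝ)} {κ Λ EA₀ E₀ δ' θ c ω ρ₀ B : ℝ} {k₀ : ℕ}
    (hr : 0 < r) (hA : TowerContracting A r) (hlaw : TowerLaw A X r Cop θ) (hread : ReadsTower M A X r W cR tow)
    (hcR : 0 ≤ cR) (hCop : 0 ≤ Cop) (hfl : ∀ k, r₀ ≤ M.rOp k) (hr₀ : 0 < r₀) (hrA : M.RepresentsA EA W)
    (hrB : M.RepresentsB EB W) (hbase : M.InBase EB W) (hlip : M.DataLipschitz W κ Λ ρ₀) (hdA : DecayBound EA W EA₀ κ)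
    (hdB : DecayBound EB W E₀ κ) (hins : M.InsertionRate W κ E₀ δ' θ) (hdamp : M.InsertionDampedNat W κ c ω)
    (hΛ : 0 ≤ Λ) (hδ' : 0 ≤ δ') (hθ : 0 ≤ θ) (hθ1 : θ ≤ 1) (hc : 0 ≤ c) (hω : 0 < ω) (hω1 : ω < 1)
    (hnear : (cR * Cop / r₀ + δ') * θ ^ k₀ + c * (EA₀ + E₀) / (1 - ω) ≤ ρ₀) (hB : 0 ≤ B)
    (hfirst : ∀ k < k₀, EA₀ + E₀ ≤ B * θ ^ k) (hsub : θ < ω + Λ * c) :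
    NE5 EA EB W κ (ω + Λ * c) ((Λ * (cR * Cop / r₀ + δ') + B) * max 1 (Λ * c / (ω + Λ * c - θ))) :=
  ne5_threshold_of_stepModel_lip_nat M hrA hrB hbase hlip hdA hdB
    (operatorRate_of_towerLaw_floor M hr hA hlaw hread hcR hCop hθ hfl hr₀) hins hdamp hΛ
    (add_nonneg (div_nonneg (mul_nonneg hcR hCop) hr₀.le) hδ') hθ hθ1 hc hω hω1 hnear hB hfirst hsub

variable [CompleteSpace Hist]

/-- **ROW NE5's END WITH NO η-RATE BINDER BUT ROW NE2's LAW** (same-data reading of the insertion, W4 PRODUCED): the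
slower-rate face with the W4 binder replaced by `ReadsIns` ∧ `InsOpEnvelope κ E₀ Gi` ∧ `InsBoundA κ E₀ Gi` ∧ the insertion
reach `(cR·Cop/r₀)·θ^{k₁} ≤ ρ₁ < 1` (`OutputRateInsertion.insertionRate_of_operatorRate` fed by §1's W1);
`δ′ = Gi(cR·Cop/r₀)/(1 − ρ₁) + 2Gi/θ^{k₁}` is displayed in `hnear` and in the constant.  Route P1's residual then reads
NE5 ⇐ NE2-law ∧ ReadsTower ∧ W2 ∧ W2-ins ∧ W3 ∧ MI-R ∧ ReadsIns ∧ S ∧ R. [folklore] -/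
theorem ne5_at_of_towerLaw_lip_readsIns_nat (Ins : ℕ → Op → (C.Dom → ℝ) → Hist)
    {A : (j : J) → (k : ℕ) → Matrix (ι j k) (ι j (k + 1)) ℂ} {X : (j : J) → (k : ℕ) → Matrix (ι j k) (ι j k) ℂ}
    {r Cop cR r₀ : ℝ} {tow : ℕ → (ℕ → ℝ) → C.BgB → J} {EA : Functional C C.BgA} {EB : Functional C C.BgB}
    {W : Set (ℕ → ℝ)} {κ Λ EA₀ E₀ Gi θ θ' c ω ρ₀ ρ₁ B : ℝ} {k₀ k₁ : ℕ} (hr : 0 < r) (hA : TowerContracting A r)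
    (hlaw : TowerLaw A X r Cop θ) (hread : ReadsTower M A X r W cR tow) (hcR : 0 ≤ cR) (hCop : 0 ≤ Cop)
    (hfl : ∀ k, r₀ ≤ M.rOp k) (hr₀ : 0 < r₀) (hrA : M.RepresentsA EA W) (hrB : M.RepresentsB EB W)
    (hbase : M.InBase EB W) (hlip : M.DataLipschitz W κ Λ ρ₀) (hdA : DecayBound EA W EA₀ κ) (hdB : DecayBound EB W E₀ κ)
    (hreadI : (InsOpModel.ofStep M Ins).ReadsIns W) (hienv : (InsOpModel.ofStep M Ins).InsOpEnvelope W κ E₀ Gi)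
    (hbdA : (InsOpModel.ofStep M Ins).InsBoundA W κ E₀ Gi) (hGi : 0 ≤ Gi) (hρ₁ : ρ₁ < 1)
    (hreach : cR * Cop / r₀ * θ ^ k₁ ≤ ρ₁) (hdamp : M.InsertionDampedNat W κ c ω) (hΛ : 0 ≤ Λ) (hθ0 : 0 < θ)
    (hθθ' : θ ≤ θ') (hθ'1 : θ' ≤ 1) (hc : 0 ≤ c) (hω : 0 < ω)
    (hnear : (cR * Cop / r₀ + (Gi * (cR * Cop / r₀) / (1 - ρ₁) + 2 * Gi / θ ^ k₁)) * θ ^ k₀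
      + c * (EA₀ + E₀) / (1 - ω) ≤ ρ₀)
    (hB : 0 ≤ B) (hfirst : ∀ k < k₀, EA₀ + E₀ ≤ B * θ ^ k) (hsmall : ω + Λ * c < θ') :
    NE5 EA EB W κ θ'
      ((Λ * (cR * Cop / r₀ + (Gi * (cR * Cop / r₀) / (1 - ρ₁) + 2 * Gi / θ ^ k₁)) + B) * (θ' - ω)
        / (θ' - (ω + Λ * c))) :=
  have hop := operatorRate_of_towerLaw_floor M hr hA hlaw hread hcR hCop hθ0.le hfl hr₀
  have hδ : 0 ≤ cR * Cop / r₀ := div_nonneg (mul_nonneg hcR hCop) hr₀.le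
  have h1ρ₁ : 0 < 1 - ρ₁ := by linarith
  M.ne5_at_of_stepModel_lip_nat hrA hrB hbase hlip hdA hdB hop
    (insertionRate_of_operatorRate M Ins hreadI hienv hbdA hop hδ hθ0 (hθθ'.trans hθ'1) hρ₁ hreach) hdamp hΛ
    (add_nonneg hδ (add_nonneg (div_nonneg (mul_nonneg hGi hδ) h1ρ₁.le)
      (div_nonneg (by positivity) (pow_pos hθ0 k₁).le))) hθ0.le hθθ' hθ'1 hc hω hnear hB hfirst hsmall

end EndFaces

/-! ## §3 The minimiser split: W1 from row NE2's law at the canonical pair and row NE3's `LocalRate`, both by name -/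

section Split

variable {J : Type*} {ι : J → ℕ → Type*} [∀ j k, Fintype (ι j k)] [∀ j k, DecidableEq (ι j k)]
variable {C : Carriers} {Op Hist : Type*} [NormedAddCommGroup Op] [NormedSpace ℂ Op] [NormedAddCommGroup Hist]
  [NormedSpace ℂ Hist] (M : StepModel C Op Hist)

/-- HYPOTHESIS SHAPE `ReadsTowerMid` (the reading of the split's FIRST leg): run A's operator datum and the INTERMEDIATE
family `opMid` (run A's fine structure at run B's transported minimiser, liaison §4) differ by at most `cR ×` the
tower increment of `tow k g U` — the canonical-pair comparison row NE2's law speaks about. [folklore] -/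
def ReadsTowerMid (A : (j : J) → (k : ℕ) → Matrix (ι j k) (ι j (k + 1)) ℂ)
    (X : (j : J) → (k : ℕ) → Matrix (ι j k) (ι j k) ℂ) (r : ℝ) (W : Set (ℕ → ℝ)) (cR : ℝ)
    (tow : ℕ → (ℕ → ℝ) → C.BgB → J) (opMid : (ℕ → ℝ) → C.BgB → ℕ → Op) : Prop :=
  ∀ k, ∀ g ∈ W, ∀ U : C.BgB,
    ‖M.opA g U k - opMid g U k‖ ≤
      cR * ‖avgTow (A (tow k g U)) r (X (tow k g U)) (k + 1) - avgTow (A (tow k g U)) r (X (tow k g U)) k‖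

/-- **W1 = NE2 ∧ NE3, BOTH BY NAME** (the minimiser-reading instantiation): [row NE2's tower law (`Cop`, rate `θ₂ ≤ θ`) read
on the pair (run A, `opMid`)] + [operator Lipschitz in the background: `‖opMid − opB‖ ≤ Λb·dist·rOp`, printed-TYPE] ×
[the minimiser distance dominated by ONE site-reading discrepancy of a `Readings` carrier with row NE3's
`LocalRate R Cm θ`] + the margin floor `r₀` ⇒ `OperatorRate W (cR·Cop/r₀ + Λb·Cm) θ` — the liaison's
`operatorRate_of_split` ∘ `minDist_of_localRate`. [folklore] -/
theorem operatorRate_of_towerLaw_split {A : (j : J) → (k : ℕ) → Matrix (ι j k) (ι j (k + 1)) ℂ}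
    {X : (j : J) → (k : ℕ) → Matrix (ι j k) (ι j k) ℂ} {r Cop θ₂ θ cR r₀ Λb Cm : ℝ} {W : Set (ℕ → ℝ)}
    {tow : ℕ → (ℕ → ℝ) → C.BgB → J} (opMid : (ℕ → ℝ) → C.BgB → ℕ → Op) (dist : ℕ → (ℕ → ℝ) → C.BgB → ℝ)
    {ιR XR : Type*} (R : Readings ιR XR) (hr : 0 < r) (hA : TowerContracting A r) (hlaw : TowerLaw A X r Cop θ₂)
    (hread : ReadsTowerMid M A X r W cR tow opMid) (hcR : 0 ≤ cR) (hCop : 0 ≤ Cop) (hθ₂ : 0 ≤ θ₂) (hθ₂θ : θ₂ ≤ θ)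
    (hfl : ∀ k, r₀ ≤ M.rOp k) (hr₀ : 0 < r₀)
    (hLip : ∀ k, ∀ g ∈ W, ∀ (U : C.BgB), ‖opMid g U k - M.opB g U k‖ ≤ Λb * dist k g U * M.rOp k) (hΛb : 0 ≤ Λb)
    (hR : LocalRate R Cm θ)
    (hdom : ∀ k, ∀ g ∈ W, ∀ (U : C.BgB), ∃ V ∈ R.dom, ∃ x : XR, dist k g U ≤ |R.loc (k + 1) V x - R.loc k V x|) :
    M.OperatorRate W (cR * Cop / r₀ + Λb * Cm) θ := by
  refine operatorRate_of_split M opMid dist (fun k g hg U => ?_) hLip (minDist_of_localRate R hR dist hdom) hΛb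
  have hinc := norm_avgTow_succ_sub_le_of_towerLaw hr hA hlaw (tow k g U) k
  have hpow : θ₂ ^ k ≤ θ ^ k := pow_le_pow_left₀ hθ₂ hθ₂θ k
  have hrOp : r₀ ≤ M.rOp k := hfl k
  have hcC : 0 ≤ cR * Cop := mul_nonneg hcR hCop
  calc ‖M.opA g U k - opMid g U k‖ ≤ cR * (Cop * θ₂ ^ k) := (hread k g hg U).trans (mul_le_mul_of_nonneg_left hinc hcR)
    _ ≤ cR * Cop * θ ^ k := by rw [← mul_assoc]; exact mul_le_mul_of_nonneg_left hpow hcC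
    _ = cR * Cop / r₀ * θ ^ k * r₀ := by field_simp
    _ ≤ cR * Cop / r₀ * θ ^ k * M.rOp k :=
        mul_le_mul_of_nonneg_left hrOp (mul_nonneg (div_nonneg hcC hr₀.le) (pow_nonneg (hθ₂.trans hθ₂θ) k))

/-- **ROW NE5's END, SLOWER-RATE FACE, W1 := NE2's LAW ∧ NE3's `LocalRate` (minimiser split).**  §2's first face with `hop`
from `operatorRate_of_towerLaw_split`; constant `(Λ(cR·Cop/r₀ + Λb·Cm + δ′) + B)(θ′ − ω)/(θ′ − (ω + Λc))`. [folklore] -/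
theorem ne5_at_of_towerLaw_split_lip_nat {A : (j : J) → (k : ℕ) → Matrix (ι j k) (ι j (k + 1)) ℂ}
    {X : (j : J) → (k : ℕ) → Matrix (ι j k) (ι j k) ℂ} {r Cop θ₂ cR r₀ Λb Cm : ℝ} {tow : ℕ → (ℕ → ℝ) → C.BgB → J}
    (opMid : (ℕ → ℝ) → C.BgB → ℕ → Op) (dist : ℕ → (ℕ → ℝ) → C.BgB → ℝ) {ιR XR : Type*} (R : Readings ιR XR)
    {EA : Functional C C.BgA} {EB : Functional C C.BgB} {W : Set (ℕ → ℝ)} {κ Λ EA₀ E₀ δ' θ θ' c ω ρ₀ B : ℝ} {k₀ : ℕ}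
    (hr : 0 < r) (hA : TowerContracting A r) (hlaw : TowerLaw A X r Cop θ₂) (hread : ReadsTowerMid M A X r W cR tow opMid)
    (hcR : 0 ≤ cR) (hCop : 0 ≤ Cop) (hθ₂ : 0 ≤ θ₂) (hθ₂θ : θ₂ ≤ θ) (hfl : ∀ k, r₀ ≤ M.rOp k) (hr₀ : 0 < r₀)
    (hLip : ∀ k, ∀ g ∈ W, ∀ (U : C.BgB), ‖opMid g U k - M.opB g U k‖ ≤ Λb * dist k g U * M.rOp k) (hΛb : 0 ≤ Λb)
    (hR : LocalRate R Cm θ) (hCm : 0 ≤ Cm)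
    (hdom : ∀ k, ∀ g ∈ W, ∀ (U : C.BgB), ∃ V ∈ R.dom, ∃ x : XR, dist k g U ≤ |R.loc (k + 1) V x - R.loc k V x|)
    (hrA : M.RepresentsA EA W) (hrB : M.RepresentsB EB W) (hbase : M.InBase EB W) (hlip : M.DataLipschitz W κ Λ ρ₀)
    (hdA : DecayBound EA W EA₀ κ) (hdB : DecayBound EB W E₀ κ) (hins : M.InsertionRate W κ E₀ δ' θ)
    (hdamp : M.InsertionDampedNat W κ c ω) (hΛ : 0 ≤ Λ) (hδ' : 0 ≤ δ') (hθθ' : θ ≤ θ') (hθ'1 : θ' ≤ 1) (hc : 0 ≤ c)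
    (hω : 0 < ω) (hnear : (cR * Cop / r₀ + Λb * Cm + δ') * θ ^ k₀ + c * (EA₀ + E₀) / (1 - ω) ≤ ρ₀) (hB : 0 ≤ B)
    (hfirst : ∀ k < k₀, EA₀ + E₀ ≤ B * θ ^ k) (hsmall : ω + Λ * c < θ') :
    NE5 EA EB W κ θ' ((Λ * (cR * Cop / r₀ + Λb * Cm + δ') + B) * (θ' - ω) / (θ' - (ω + Λ * c))) :=
  M.ne5_at_of_stepModel_lip_nat hrA hrB hbase hlip hdA hdB
    (operatorRate_of_towerLaw_split M opMid dist R hr hA hlaw hread hcR hCop hθ₂ hθ₂θ hfl hr₀ hLip hΛb hR hdom) hins hdamp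
    hΛ (add_nonneg (add_nonneg (div_nonneg (mul_nonneg hcR hCop) hr₀.le) (mul_nonneg hΛb hCm)) hδ') (hθ₂.trans hθ₂θ)
    hθθ' hθ'1 hc hω hnear hB hfirst hsmall

end Split

/-! ## §3b (v1.1, APPEND-ONLY) The minimiser split AND the produced W4 in one END face -/

section SplitReadsIns

variable {J : Type*} {ι : J → ℕ → Type*} [∀ j k, Fintype (ι j k)] [∀ j k, DecidableEq (ι j k)]
variable {C : Carriers} {Op Hist : Type*} [NormedAddCommGroup Op] [NormedSpace ℂ Op] [NormedAddCommGroup Hist]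
  [NormedSpace ℂ Hist] [CompleteSpace Hist] (M : StepModel C Op Hist)

/-- **ROW NE5's END, W1 := NE2's LAW ∧ NE3's `LocalRate` (minimiser split) AND W4 PRODUCED (same-data insertion reading).**
§3's `operatorRate_of_towerLaw_split` gives W1 with `δ = cR·Cop/r₀ + Λb·Cm`; `OutputRateInsertion.insertionRate_of_operatorRate`
turns the SAME W1 into W4 with `δ′ = Gi·δ/(1 − ρ₁) + 2Gi/θ^{k₁}` under `ReadsIns` ∧ `InsOpEnvelope κ E₀ Gi` ∧ `InsBoundA κ E₀ Gi` ∧ the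
insertion reach `δ·θ^{k₁} ≤ ρ₁ < 1`; then the Data leaf's `ne5_at_of_stepModel_lip_nat`.  NO η-rate binder is left except row
NE2's tower law and row NE3's `LocalRate`: NE5 ⇐ NE2-law ∧ ReadsTowerMid ∧ bg-Lipschitz ∧ NE3-LocalRate ∧ floor ∧ W2 ∧ W2-ins ∧ W3 ∧
MI-R ∧ ReadsIns ∧ S ∧ R.  The abbreviation `hδ : cR·Cop/r₀ + Λb·Cm = δ` keeps the displayed constant readable. [folklore] -/
theorem ne5_at_of_towerLaw_split_readsIns_nat (Ins : ℕ → Op → (C.Dom → ℝ) → Hist)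
    {A : (j : J) → (k : ℕ) → Matrix (ι j k) (ι j (k + 1)) ℂ} {X : (j : J) → (k : ℕ) → Matrix (ι j k) (ι j k) ℂ}
    {r Cop θ₂ cR r₀ Λb Cm δ : ℝ} {tow : ℕ → (ℕ → ℝ) → C.BgB → J} (opMid : (ℕ → ℝ) → C.BgB → ℕ → Op)
    (dist : ℕ → (ℕ → ℝ) → C.BgB → ℝ) {ιR XR : Type*} (R : Readings ιR XR) {EA : Functional C C.BgA}
    {EB : Functional C C.BgB} {W : Set (ℕ → ℝ)} {κ Λ EA₀ E₀ Gi θ θ' c ω ρ₀ ρ₁ B : ℝ} {k₀ k₁ : ℕ} (hr : 0 < r)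
    (hA : TowerContracting A r) (hlaw : TowerLaw A X r Cop θ₂) (hread : ReadsTowerMid M A X r W cR tow opMid)
    (hcR : 0 ≤ cR) (hCop : 0 ≤ Cop) (hθ₂ : 0 ≤ θ₂) (hθ₂θ : θ₂ ≤ θ) (hfl : ∀ k, r₀ ≤ M.rOp k) (hr₀ : 0 < r₀)
    (hLip : ∀ k, ∀ g ∈ W, ∀ (U : C.BgB), ‖opMid g U k - M.opB g U k‖ ≤ Λb * dist k g U * M.rOp k) (hΛb : 0 ≤ Λb)
    (hR : LocalRate R Cm θ) (hCm : 0 ≤ Cm)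
    (hdom : ∀ k, ∀ g ∈ W, ∀ (U : C.BgB), ∃ V ∈ R.dom, ∃ x : XR, dist k g U ≤ |R.loc (k + 1) V x - R.loc k V x|)
    (hδ : cR * Cop / r₀ + Λb * Cm = δ) (hrA : M.RepresentsA EA W) (hrB : M.RepresentsB EB W) (hbase : M.InBase EB W)
    (hlip : M.DataLipschitz W κ Λ ρ₀) (hdA : DecayBound EA W EA₀ κ) (hdB : DecayBound EB W E₀ κ)
    (hreadI : (InsOpModel.ofStep M Ins).ReadsIns W) (hienv : (InsOpModel.ofStep M Ins).InsOpEnvelope W κ E₀ Gi)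
    (hbdA : (InsOpModel.ofStep M Ins).InsBoundA W κ E₀ Gi) (hGi : 0 ≤ Gi) (hρ₁ : ρ₁ < 1) (hreach : δ * θ ^ k₁ ≤ ρ₁)
    (hdamp : M.InsertionDampedNat W κ c ω) (hΛ : 0 ≤ Λ) (hθ0 : 0 < θ) (hθθ' : θ ≤ θ') (hθ'1 : θ' ≤ 1) (hc : 0 ≤ c)
    (hω : 0 < ω)
    (hnear : (δ + (Gi * δ / (1 - ρ₁) + 2 * Gi / θ ^ k₁)) * θ ^ k₀ + c * (EA₀ + E₀) / (1 - ω) ≤ ρ₀) (hB : 0 ≤ B)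
    (hfirst : ∀ k < k₀, EA₀ + E₀ ≤ B * θ ^ k) (hsmall : ω + Λ * c < θ') :
    NE5 EA EB W κ θ'
      ((Λ * (δ + (Gi * δ / (1 - ρ₁) + 2 * Gi / θ ^ k₁)) + B) * (θ' - ω) / (θ' - (ω + Λ * c))) := by
  have hop : M.OperatorRate W δ θ :=
    hδ ▸ operatorRate_of_towerLaw_split M opMid dist R hr hA hlaw hread hcR hCop hθ₂ hθ₂θ hfl hr₀ hLip hΛb hR hdom
  have hδ0 : 0 ≤ δ := hδ ▸ add_nonneg (div_nonneg (mul_nonneg hcR hCop) hr₀.le) (mul_nonneg hΛb hCm)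
  have h1ρ₁ : 0 < 1 - ρ₁ := by linarith
  exact M.ne5_at_of_stepModel_lip_nat hrA hrB hbase hlip hdA hdB hop
    (insertionRate_of_operatorRate M Ins hreadI hienv hbdA hop hδ0 hθ0 (hθθ'.trans hθ'1) hρ₁ hreach) hdamp hΛ
    (add_nonneg hδ0 (add_nonneg (div_nonneg (mul_nonneg hGi hδ0) h1ρ₁.le)
      (div_nonneg (by positivity) (pow_pos hθ0 k₁).le))) hθ0.le hθθ' hθ'1 hc hω hnear hB hfirst hsmall

end SplitReadsIns

end Summit.QuantumFields.BalabanUV.T4Continuum.OutputRateTowerSocket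

end
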